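import Literature.Topology.FourManifolds.HandleTubeDepthField
import Literature.Topology.FourManifolds.CircleTubeTransition
import Literature.Topology.FourManifolds.RegularDomainMaps
import HarnessLib

/-!
# The boundary tube of an attaching map of a 2-handle

Topic `Literature/Topology/FourManifolds`; infrastructure for the isotopy invariance of
2-handle attachment (`Geometry/Symplectic/TwoHandleIsotopy.lean`, named fact
`HandleAttachingMap.isMultiAttachment_of_linkIsotopyInBoundary`).  An attaching map
`f : T → W` of a 2-handle (`HandleAttachingMap 3 2 W`, Kosinski's `h̄`) restricts on the sphere
part `T ∩ ∂D⁴` of the tube to Kosinski's `h : S¹ × D² ↪ ∂W`, a tubular neighbourhood of the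
attaching circle **in the boundary 3-manifold `∂W`** (Kosinski, *Differential Manifolds* (1993),
VI §5, (5.1): *"`h` is an imbedding of `S^{λ-1} × D^{m-λ}` in `∂M`"*).  Here this restriction is
packaged as a `CircleTube ↥(∂W)` (`CircleTubeTransition.lean`), the shape in which the
uniqueness of tubular neighbourhoods of a circle in a 3-manifold is available:

* `HandleAttachingMap.boundaryTube f : CircleTube ↥((𝓡∂ 4).boundary W)` — the partial
  homeomorphism `(θ, v) ↦ f (depthLine θ v 0)` (`HandleTubeDepthField.lean`: the point of
  `T ∩ ∂D⁴` of angle `θ` and fibre `v`, `‖v‖ < 1`) onto `∂W ∩ range f`, with inverse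
  `p ↦ (tubeAngle (f⁻¹ p), tubeFibre (f⁻¹ p))`; smooth for the boundary structure
  (`BoundaryManifold.contMDiffOn_codRestrict`, `BoundaryManifold.contMDiffAt_comp_val`);
* its core is the attaching circle (`coe_boundaryTube_core`), so two attaching maps with the
  same attaching circle have boundary tubes with the same core (`boundaryTube_core_eq`).

Everything here is proved; no named fact is introduced.

## References

* A. A. Kosinski, *Differential Manifolds*, Academic Press (1993), VI §5 (5.1), III (3.1).
  [Kosinski1993]
-/

open scoped Manifold ContDiff Topology
open Set Function Metric Filter

noncomputable section

namespace Literature.Topology.FourManifolds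

/-- Local notation: `𝔼 n` is the model Euclidean space `EuclideanSpace ℝ (Fin n)`. -/
local notation "𝔼 " n:arg => EuclideanSpace ℝ (Fin n)

/-- Local notation: `𝕊 n` is the unit sphere in `EuclideanSpace ℝ (Fin (n + 1))`. -/
local notation "𝕊 " n:arg => (Metric.sphere (0 : EuclideanSpace ℝ (Fin (n + 1))) 1)

/-- Local notation: `𝔻 n` is the closed unit ball in `EuclideanSpace ℝ (Fin n)`. -/
local notation "𝔻 " n:arg => (Metric.closedBall (0 : EuclideanSpace ℝ (Fin n)) 1)

set_option quotPrecheck false in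
/-- Local notation: Kosinski's tube `T ⊆ D⁴` of the circle `S¹ × 0`, as a type. -/
local notation "𝕋" => ↥(handleTube 3 2)

/-- Local notation: the model with corners of the tube `S¹ × ℝ²`. -/
local notation "I𝕋₁" => (ModelWithCorners.prod (𝓡 1) 𝓘(ℝ, EuclideanSpace ℝ (Fin 2)))

attribute [local instance] fact_finrank_euclideanSpace_succ

/-! ### The sphere points `depthLine θ v 0` as a smooth function of `(θ, v)` -/

section DepthLineZero

/-- The depth line through the circle point of angle `θ` (fibre `0`) starts at `coreTubePt θ`.
[folklore] -/
theorem depthLine_zero_zero (θ : 𝕊 1) : depthLine θ 0 0 = coreTubePt θ := by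
  have h := depthLine_tube (coreTubePt θ)
  rwa [tubeAngle_coreTubePt, tubeFibre_coreTubePt, tubeDepth_coreTubePt] at h

/-- On the unit tube the fibre leaves room: `0 < 1 - 0 - ‖v‖²` for `‖v‖ < 1`. [folklore] -/
theorem depthLine_zero_cond {q : (𝕊 1) × 𝔼 2} (hq : q ∈ (univ : Set (𝕊 1)) ×ˢ ball (0 : 𝔼 2) 1) :
    0 < 1 - 0 - ‖q.2‖ ^ 2 := by
  obtain ⟨-, hv⟩ := hq
  rw [mem_ball_zero_iff] at hv
  have h0 := norm_nonneg q.2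
  nlinarith

/-- **The sphere point `(θ, v) ↦ depthLine θ v 0 ∈ T` is smooth on the unit tube
`S¹ × B(0, 1)`** (into the open submanifold `T` of `D⁴`: its vector is `mkVec θ v 0`, smooth by
`contMDiffOn_mkVec`; test in `ℝ⁴`, `codRestrict_closedBall`, `subtypeVal_comp_iff`).
[folklore] -/
theorem contMDiffOn_depthLine_zero :
    ContMDiffOn I𝕋₁ (𝓡∂ 4) ∞ (fun q : (𝕊 1) × 𝔼 2 => depthLine q.1 q.2 0)
      ((univ : Set (𝕊 1)) ×ˢ ball (0 : 𝔼 2) 1) := by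
  intro q₀ hq₀
  have hU : IsOpen ((univ : Set (𝕊 1)) ×ˢ ball (0 : 𝔼 2) 1) := isOpen_univ.prod isOpen_ball
  apply ContMDiffAt.contMDiffWithinAt
  set F : (𝕊 1) × 𝔼 2 → 𝔼 4 := fun q => tubeVec (depthLine q.1 q.2 0) with hF
  have hFV : ContMDiffOn I𝕋₁ 𝓘(ℝ, 𝔼 4) ∞
      (fun q : (𝕊 1) × 𝔼 2 => mkVec ((q.1 : 𝕊 1) : 𝔼 2) q.2 0)
      ((univ : Set (𝕊 1)) ×ˢ ball (0 : 𝔼 2) 1) :=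
    contMDiffOn_mkVec (contMDiff_coe_sphere.comp contMDiff_fst).contMDiffOn
      contMDiff_snd.contMDiffOn contMDiffOn_const fun q hq => depthLine_zero_cond hq
  have hFs : ContMDiffOn I𝕋₁ 𝓘(ℝ, 𝔼 4) ∞ F ((univ : Set (𝕊 1)) ×ˢ ball (0 : 𝔼 2) 1) :=
    hFV.congr fun q hq => tubeVec_depthLine q.1 q.2 le_rfl (depthLine_zero_cond hq)
  have hFat : ContMDiffAt I𝕋₁ 𝓘(ℝ, 𝔼 4) ∞ F q₀ := (hFs q₀ hq₀).contMDiffAt (hU.mem_nhds hq₀)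
  have hmem : ∀ q, F q ∈ 𝔻 4 := fun q => ((depthLine q.1 q.2 0 : 𝕋) : 𝔻 4).2
  have h1 := hFat.codRestrict_closedBall hmem
  have h2 : Set.codRestrict F (𝔻 4) hmem =
      Subtype.val ∘ fun q : (𝕊 1) × 𝔼 2 => depthLine q.1 q.2 0 := by
    funext q; exact Subtype.ext rfl
  rw [h2] at h1
  exact (ContMDiffAt.subtypeVal_comp_iff (handleTube 3 2) _ q₀).1 h1

end DepthLineZero

/-! ### The boundary tube -/

namespace HandleAttachingMap

variable {W : Type*} [TopologicalSpace W] [ChartedSpace (EuclideanHalfSpace 4) W]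

set_option quotPrecheck false in
/-- Local notation: the boundary 3-manifold `∂W` of `W`, as a type. -/
local notation "∂𝕎" => ↥((𝓡∂ 4).boundary W)

variable (f : HandleAttachingMap 3 2 W)

/-- **The boundary tube map** `(θ, v) ↦ f (depthLine θ v 0) ∈ ∂W` of an attaching map (its
values lie in `∂W` by `apply_mem_boundary_iff`: the sphere points have norm `1`).
[cite: Kosinski1993, VI §5 (5.1)] -/
def boundaryTubeFun : (𝕊 1) × 𝔼 2 → ∂𝕎 :=
  ((𝓡∂ 4).boundary W).codRestrict (fun q : (𝕊 1) × 𝔼 2 => f.toFun (depthLine q.1 q.2 0))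
    fun q => (f.apply_mem_boundary_iff _).2 (norm_tubeVec_depthLine_zero q.1 q.2)

/-- The boundary tube map, as a point of `W`. [folklore] -/
@[simp] theorem coe_boundaryTubeFun (q : (𝕊 1) × 𝔼 2) :
    (f.boundaryTubeFun q : W) = f.toFun (depthLine q.1 q.2 0) := rfl

/-- **The inverse of the boundary tube map**: `p ↦ (tubeAngle (f⁻¹ p), tubeFibre (f⁻¹ p))`.
[folklore] -/
def boundaryTubeInv (p : ∂𝕎) : (𝕊 1) × 𝔼 2 :=
  (tubeAngle (f.toHomeo.symm (p : W)), tubeFibre (f.toHomeo.symm (p : W)))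

/-- Unfolding the inverse. [folklore] -/
theorem boundaryTubeInv_apply (p : ∂𝕎) :
    f.boundaryTubeInv p = (tubeAngle (f.toHomeo.symm (p : W)), tubeFibre (f.toHomeo.symm (p : W))) :=
  rfl

/-- `inv ∘ fun = id` on the unit tube. [folklore] -/
theorem boundaryTubeInv_boundaryTubeFun {q : (𝕊 1) × 𝔼 2}
    (hq : q ∈ (univ : Set (𝕊 1)) ×ˢ ball (0 : 𝔼 2) 1) :
    f.boundaryTubeInv (f.boundaryTubeFun q) = q := by
  have hpos := depthLine_zero_cond hq
  obtain ⟨θ, v⟩ := q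
  rw [boundaryTubeInv_apply, coe_boundaryTubeFun, toHomeo_symm_apply,
    tubeAngle_depthLine θ v le_rfl hpos, tubeFibre_depthLine θ v le_rfl hpos]

/-- `fun ∘ inv = id` on `∂W ∩ range f` (a point of `∂W` in the range is the image of a sphere
point, which is the start of its own depth line). [folklore] -/
theorem boundaryTubeFun_boundaryTubeInv {p : ∂𝕎} (hp : (p : W) ∈ range f.toFun) :
    f.boundaryTubeFun (f.boundaryTubeInv p) = p := by
  apply Subtype.ext
  set y := f.toHomeo.symm (p : W) with hy_def
  have hy : f.toFun y = p := f.apply_toHomeo_symm hp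
  have h1 : ‖tubeVec y‖ = 1 := (f.apply_mem_boundary_iff y).1 (by rw [hy]; exact p.2)
  have hd : tubeDepth y = 0 := (tubeDepth_eq_zero_iff y).2 h1
  rw [coe_boundaryTubeFun, boundaryTubeInv_apply]
  show f.toFun (depthLine (tubeAngle y) (tubeFibre y) 0) = p
  rw [← hd, depthLine_tube, hy]

variable [IsManifold (𝓡∂ 4) ∞ W]

/-- **The boundary tube map is smooth on the unit tube** for the boundary structure of `∂W`
(`f ∘ depthLine(·, ·, 0)` is smooth into `W` with values in `∂W`;
`BoundaryManifold.contMDiffOn_codRestrict`). [folklore] -/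
theorem contMDiffOn_boundaryTubeFun :
    ContMDiffOn I𝕋₁ (𝓡 3) ∞ f.boundaryTubeFun ((univ : Set (𝕊 1)) ×ˢ ball (0 : 𝔼 2) 1) := by
  have hg : ContMDiffOn I𝕋₁ (𝓡∂ 4) ∞ (fun q : (𝕊 1) × 𝔼 2 => f.toFun (depthLine q.1 q.2 0))
      ((univ : Set (𝕊 1)) ×ˢ ball (0 : 𝔼 2) 1) :=
    f.isSmoothEmbedding.contMDiff.comp_contMDiffOn contMDiffOn_depthLine_zero
  exact BoundaryManifold.contMDiffOn_codRestrict _ (isOpen_univ.prod isOpen_ball) hg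

/-- **The inverse of the boundary tube map is smooth on `∂W ∩ range f`** (`f⁻¹` is smooth on
the range, `contMDiffAt_toHomeo_symm`, restricted along the smooth embedding `∂W ↪ W`,
`BoundaryManifold.contMDiffAt_comp_val`; then `tubeAngle`, `tubeFibre` are smooth). [folklore] -/
theorem contMDiffOn_boundaryTubeInv :
    ContMDiffOn (𝓡 3) I𝕋₁ ∞ f.boundaryTubeInv {p : ∂𝕎 | (p : W) ∈ range f.toFun} := by
  intro p hp
  apply ContMDiffAt.contMDiffWithinAt
  have h1 : ContMDiffAt (𝓡 3) (𝓡∂ 4) ∞ (f.toHomeo.symm ∘ Subtype.val : ∂𝕎 → 𝕋) p :=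
    BoundaryManifold.contMDiffAt_comp_val (f.contMDiffAt_toHomeo_symm hp)
  exact (contMDiff_tubeAngle.contMDiffAt.comp p h1).prodMk
    (contMDiff_tubeFibre.contMDiffAt.comp p h1)

/-- **The boundary tube of an attaching map of a 2-handle**: Kosinski's `h = h̄ | S¹ × D²`, the
tubular neighbourhood `(θ, v) ↦ h̄ (depthLine θ v 0)` of the attaching circle in the boundary
3-manifold `∂W`, as a `CircleTube ↥(∂W)` with target `∂W ∩ range h̄`.
[cite: Kosinski1993, VI §5 (5.1)] -/
def boundaryTube : CircleTube ∂𝕎 where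
  toHomeo :=
  { toFun := f.boundaryTubeFun
    invFun := f.boundaryTubeInv
    source := (univ : Set (𝕊 1)) ×ˢ ball (0 : 𝔼 2) 1
    target := {p : ∂𝕎 | (p : W) ∈ range f.toFun}
    map_source' := fun _ _ => mem_range_self _
    map_target' := fun _ _ => ⟨mem_univ _, mem_ball_zero_iff.2 (norm_tubeFibre_lt_one _)⟩
    left_inv' := fun _ hq => f.boundaryTubeInv_boundaryTubeFun hq
    right_inv' := fun _ hp => f.boundaryTubeFun_boundaryTubeInv hp
    open_source := isOpen_univ.prod isOpen_ball
    open_target := f.isOpen_range.preimage continuous_subtype_val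
    continuousOn_toFun := f.contMDiffOn_boundaryTubeFun.continuousOn
    continuousOn_invFun := f.contMDiffOn_boundaryTubeInv.continuousOn }
  source_eq := rfl
  contMDiffOn_toHomeo := f.contMDiffOn_boundaryTubeFun
  contMDiffOn_symm := f.contMDiffOn_boundaryTubeInv

/-- The boundary tube is the boundary tube map, as a function. [folklore] -/
@[simp] theorem boundaryTube_apply (q : (𝕊 1) × 𝔼 2) :
    f.boundaryTube.toHomeo q = f.boundaryTubeFun q := rfl

/-- The boundary tube at `(θ, v)`, as a point of `W`, is `f (depthLine θ v 0)`. [folklore] -/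
theorem coe_boundaryTube_apply (θ : 𝕊 1) (v : 𝔼 2) :
    ((f.boundaryTube.toHomeo (θ, v) : ∂𝕎) : W) = f.toFun (depthLine θ v 0) := rfl

/-- The inverse of the boundary tube, as a function. [folklore] -/
@[simp] theorem boundaryTube_symm_apply (p : ∂𝕎) :
    f.boundaryTube.toHomeo.symm p =
      (tubeAngle (f.toHomeo.symm (p : W)), tubeFibre (f.toHomeo.symm (p : W))) := rfl

/-- The source of the boundary tube is the unit tube. [folklore] -/
theorem boundaryTube_source :
    f.boundaryTube.toHomeo.source = (univ : Set (𝕊 1)) ×ˢ ball (0 : 𝔼 2) 1 := rfl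

/-- The target of the boundary tube is `∂W ∩ range f`. [folklore] -/
theorem boundaryTube_target :
    f.boundaryTube.toHomeo.target = {p : ∂𝕎 | (p : W) ∈ range f.toFun} := rfl

/-- Membership in the target of the boundary tube. [folklore] -/
theorem mem_boundaryTube_target_iff {p : ∂𝕎} :
    p ∈ f.boundaryTube.toHomeo.target ↔ (p : W) ∈ range f.toFun := Iff.rfl

/-- **The core of the boundary tube is the attaching circle.** [cite: Kosinski1993, VI §5 (5.1)] -/
theorem coe_boundaryTube_core (θ : 𝕊 1) :
    ((f.boundaryTube.core θ : ∂𝕎) : W) = f.attachingCircle θ := by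
  rw [CircleTube.core_apply, coe_boundaryTube_apply, depthLine_zero_zero]
  rfl

omit [IsManifold (𝓡∂ 4) ∞ W] in
/-- Two attaching maps with the same attaching circle have boundary tubes with the same core.
[folklore] -/
theorem boundaryTube_core_eq [IsManifold (𝓡∂ 4) ∞ W] {f g : HandleAttachingMap 3 2 W}
    (h : f.attachingCircle = g.attachingCircle) (θ : 𝕊 1) :
    f.boundaryTube.core θ = g.boundaryTube.core θ := by
  apply Subtype.ext
  rw [coe_boundaryTube_core, coe_boundaryTube_core, h]

/-- The targets of the boundary tubes of attaching maps with disjoint ranges are disjoint.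
[folklore] -/
theorem disjoint_boundaryTube_target {f g : HandleAttachingMap 3 2 W}
    (h : Disjoint (range f.toFun) (range g.toFun)) :
    Disjoint f.boundaryTube.toHomeo.target g.boundaryTube.toHomeo.target := by
  rw [Set.disjoint_left]
  intro p hpf hpg
  exact Set.disjoint_left.1 h hpf hpg

end HandleAttachingMap

end Literature.Topology.FourManifolds

end
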